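import Literature.GroupTheory.CombinatorialGroupTheory.RandomSclFreeGroupCombAdmissible
import HarnessLib

/-!
# Random rigidity of scl (Calegari–Walker 2013): proofs, part 27 — combs in an abstract
resolved boundary ("token structures"): extraction of the comb configuration

D. Calegari, A. Walker, *Random rigidity in the free group*, Geom. Topol. 17 (2013)
[CalegariWalker2013], §4.4–4.5 (combs, Def. 4.10) and §4.7. The boundary of a trivalent fatgraph
(possibly with edges of length `0`) with boundary word the cyclic word `W = (v′)^M` of length `N`
is encoded as a **token structure**: `Tn` tokens (the sides of the edges in boundary order, index
`p`, successor `S p = p + 1 mod Tn`, predecessor `S⁻¹ p = p + Tn − 1 mod Tn`), lengths `len p`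
(fake sides of `0`-length edges have length `0`), first-letter positions `start p < N`,
consecutivity `start (S p) ≡ start p + len p (mod N)`, a length-preserving involution `P` (the two
sides of an edge), the **trivalence axiom** `P (S (P p)) = S⁻¹ (P (S⁻¹ p))` (the vertex
permutation has order `3`), and the **word axiom**: the side `P p` reads the inverse of the side
`p` (letters read in `v′`, placed at offset `off` inside a longer word `vg`).
A comb of complexity `d` at `p`: the arc = tokens `p, …, p+d`; at the junction before `p+e` the
third edge has sides `S (P (p+e))` (after the partner of `p+e`) and `S⁻¹ (P (p+e−1))` (before the
partner of `p+e−1`) — partners of each other by trivalence. This gives EXACTLY the `D`- and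
`F`-constraints of the comb configuration of part 25/26.

* **`start_add_mod`** — `start (p+i) ≡ start p + Σ_{i'<i} len (p+i') (mod N)`.
* **`comb_event_of_good`** — a good comb (lengths `≤ ℓmax`, arc and blocks inside one period,
  regular arc) of total length `≥ Emin` yields the EVENT of `card_filter_exists_combConfig_le`.
-/

noncomputable section

namespace Literature.GroupTheory.CombinatorialGroupTheory

section TokenCombs

open Finset

open scoped Classical

/-- `S (S⁻¹ x) = x` on `[0, Tn)`. [folklore] -/
theorem succ_pred_mod {Tn : ℕ} (x : ℕ) (hx : x < Tn) : ((x + Tn - 1) % Tn + 1) % Tn = x := by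
  rcases Nat.eq_zero_or_pos x with h | h
  · subst h
    rw [Nat.zero_add, Nat.mod_eq_of_lt (by omega : Tn - 1 < Tn), Nat.sub_add_cancel (by omega),
      Nat.mod_self]
  · rw [show x + Tn - 1 = (x - 1) + Tn by omega, Nat.add_mod_right,
      Nat.mod_eq_of_lt (by omega : x - 1 < Tn), Nat.sub_add_cancel h, Nat.mod_eq_of_lt hx]

/-- `S⁻¹ (S x) = x` on `[0, Tn)`. [folklore] -/
theorem pred_succ_mod {Tn : ℕ} (x : ℕ) (hx : x < Tn) : ((x + 1) % Tn + Tn - 1) % Tn = x := by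
  by_cases h : x + 1 < Tn
  · rw [Nat.mod_eq_of_lt h, show x + 1 + Tn - 1 = x + Tn by omega, Nat.add_mod_right,
      Nat.mod_eq_of_lt hx]
  · have : x + 1 = Tn := by omega
    rw [this, Nat.mod_self, Nat.zero_add, Nat.mod_eq_of_lt (by omega)]
    omega

/-- `(x + y) % n = x % n + y` when `x % n + y < n`. [folklore] -/
theorem add_mod_eq_of_lt {x y n : ℕ} (h : x % n + y < n) : (x + y) % n = x % n + y := by
  rw [Nat.add_mod, Nat.mod_eq_of_lt (show y < n by omega), Nat.mod_eq_of_lt h]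

/-- **Iterated consecutivity.** `start (p + i) ≡ start p + Σ_{i' < i} len (p + i')  (mod N)`.
[folklore] -/
theorem start_add_mod {Tn N : ℕ} (start len : ℕ → ℕ) (hstart : ∀ p, p < Tn → start p < N)
    (hcons : ∀ p, p < Tn → start ((p + 1) % Tn) = (start p + len p) % N) (p : ℕ) (hp : p < Tn)
    (i : ℕ) :
    start ((p + i) % Tn) = (start p + ∑ i' ∈ Finset.range i, len ((p + i') % Tn)) % N := by
  have hTn : 0 < Tn := by omega
  induction i with
  | zero =>
    rw [Finset.range_zero, Finset.sum_empty, Nat.add_zero, Nat.add_zero, Nat.mod_eq_of_lt hp,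
      Nat.mod_eq_of_lt (hstart p hp)]
  | succ i ih =>
    have h1 : (p + (i + 1)) % Tn = ((p + i) % Tn + 1) % Tn := by
      rw [Nat.mod_add_mod, Nat.add_assoc]
    rw [h1, hcons _ (Nat.mod_lt _ hTn), ih, Finset.sum_range_succ, Nat.mod_add_mod]
    congr 1
    ring

set_option maxHeartbeats 1600000 in
/-- **Extraction of the comb configuration from a good comb (CW Def. 4.10, §4.7).** In a token
structure (see the module docstring) whose word axiom is read in a word `vg` at offset `off`
with period `n′` (`off + n′ ≤ n`), let `p` be a comb of complexity `d` such that: all arc sides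
`p + i` and third edges `S (P (p+e))` have length `≤ ℓmax`; the arc and every block
`S⁻¹(P(p+i)), P(p+i), S(P(p+i))` lie inside one period; its total length is `≥ Emin`; and its arc
is `g`-regular. Then the word `vg` carries the comb configuration EVENT of
`card_filter_exists_combConfig_le` (with `n`, `d`, `ℓmax`, `g`, `Emin`).
[cite: CalegariWalker2013, Def. 4.10 and §4.7] -/
theorem comb_event_of_good {A : Type*} (inv : A → A)
    {Tn N n' n off d ℓmax g Emin : ℕ} (hNn : n' ∣ N) (hoff : off + n' ≤ n)
    (vg : ℕ → A) (start len P : ℕ → ℕ)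
    (hstart : ∀ p, p < Tn → start p < N)
    (hcons : ∀ p, p < Tn → start ((p + 1) % Tn) = (start p + len p) % N)
    (hP : ∀ p, p < Tn → P p < Tn ∧ P (P p) = p)
    (hlenP : ∀ p, p < Tn → len (P p) = len p)
    (htri : ∀ p, p < Tn → P ((P p + 1) % Tn) = (P ((p + Tn - 1) % Tn) + Tn - 1) % Tn)
    (hword : ∀ p, p < Tn → ∀ j, j < len p →
      vg (off + (start (P p) + j) % n') = inv (vg (off + (start p + (len p - 1 - j)) % n')))
    (p : ℕ) (hp : p < Tn)
    (hlenA : ∀ i, i < d + 1 → len ((p + i) % Tn) ≤ ℓmax)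
    (hlenK : ∀ e, 1 ≤ e → e ≤ d → len ((P ((p + e) % Tn) + 1) % Tn) ≤ ℓmax)
    (harc : start p % n' + ∑ i ∈ Finset.range (d + 1), len ((p + i) % Tn) ≤ n')
    (hblk : ∀ i, i < d + 1 →
      start ((P ((p + i) % Tn) + Tn - 1) % Tn) % n' +
        (len ((P ((p + i) % Tn) + Tn - 1) % Tn) + len ((p + i) % Tn) +
          len ((P ((p + i) % Tn) + 1) % Tn)) ≤ n')
    (hE : Emin ≤ (∑ i ∈ Finset.range (d + 1), len ((p + i) % Tn)) +
      ∑ e ∈ Finset.range (d + 2), (if 1 ≤ e ∧ e ≤ d then len ((P ((p + e) % Tn) + 1) % Tn) else 0))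
    (hreg1 : ∀ x y, x ≠ y → x + g ≤ ∑ i ∈ Finset.range (d + 1), len ((p + i) % Tn) →
      y + g ≤ ∑ i ∈ Finset.range (d + 1), len ((p + i) % Tn) →
        ∃ q, q < g ∧ vg (off + start p % n' + x + q) ≠ vg (off + start p % n' + y + q))
    (hreg2 : ∀ x y, x + g ≤ ∑ i ∈ Finset.range (d + 1), len ((p + i) % Tn) →
      y + g ≤ ∑ i ∈ Finset.range (d + 1), len ((p + i) % Tn) →
        ∃ q, q < g ∧ vg (off + start p % n' + x + q) ≠
          inv (vg (off + start p % n' + y + (g - 1 - q)))) :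
    ∃ (s : ℕ) (t lam kap : ℕ → ℕ),
      ((∀ i, i < d + 1 → lam i ≤ ℓmax) ∧ (∀ e, e < d + 2 → kap e ≤ ℓmax) ∧ kap 0 = 0 ∧
          kap (d + 1) = 0 ∧ s + ∑ i ∈ Finset.range (d + 1), lam i ≤ n ∧
          (∀ i, i < d + 1 → kap (i + 1) ≤ t i ∧ t i + lam i + kap i ≤ n) ∧
          Emin ≤ (∑ i ∈ Finset.range (d + 1), lam i) + ∑ e ∈ Finset.range (d + 2), kap e) ∧
      (∀ i, i < d + 1 → ∀ j, j < lam i →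
        vg (t i + j) = inv (vg (s + (∑ i' ∈ Finset.range i, lam i') + (lam i - 1 - j)))) ∧
      (∀ e, 1 ≤ e → e ≤ d → ∀ j, j < kap e →
        vg (t e + lam e + j) = inv (vg (t (e - 1) - 1 - j))) ∧
      (∀ x y, x ≠ y → x + g ≤ ∑ i' ∈ Finset.range (d + 1), lam i' →
        y + g ≤ ∑ i' ∈ Finset.range (d + 1), lam i' →
          ∃ q, q < g ∧ vg (s + x + q) ≠ vg (s + y + q)) ∧
      (∀ x y, x + g ≤ ∑ i' ∈ Finset.range (d + 1), lam i' →
        y + g ≤ ∑ i' ∈ Finset.range (d + 1), lam i' →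
          ∃ q, q < g ∧ vg (s + x + q) ≠ inv (vg (s + y + (g - 1 - q)))) := by
  have hTn : 0 < Tn := by omega
  -- ### notation
  set q_ : ℕ → ℕ := fun i => (p + i) % Tn with hq_
  set Sx : ℕ → ℕ := fun x => (x + 1) % Tn with hSx
  set Si : ℕ → ℕ := fun x => (x + Tn - 1) % Tn with hSi
  have hq_lt : ∀ i, q_ i < Tn := fun i => Nat.mod_lt _ hTn
  have hSx_lt : ∀ x, Sx x < Tn := fun x => Nat.mod_lt _ hTn
  have hSi_lt : ∀ x, Si x < Tn := fun x => Nat.mod_lt _ hTn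
  have hP_lt : ∀ x, x < Tn → P x < Tn := fun x hx => (hP x hx).1
  have hPP : ∀ x, x < Tn → P (P x) = x := fun x hx => (hP x hx).2
  -- `S⁻¹ (q_ e) = q_ (e - 1)`
  have hSi_q : ∀ e, 1 ≤ e → Si (q_ e) = q_ (e - 1) := by
    intro e he
    have h1 : q_ e = Sx (q_ (e - 1)) := by
      simp only [hq_, hSx]
      rw [Nat.mod_add_mod, show p + (e - 1) + 1 = p + e by omega]
    rw [h1]
    exact pred_succ_mod _ (hq_lt _)
  -- blocks: `B i = S⁻¹ (P (q_ i))`, `D i = P (q_ i)`, `C i = S (P (q_ i))`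
  set B : ℕ → ℕ := fun i => Si (P (q_ i)) with hB
  set C : ℕ → ℕ := fun i => Sx (P (q_ i)) with hC
  -- trivalence: `P (C (e)) = B (e - 1)` for `e ≥ 1`
  have hPC : ∀ e, 1 ≤ e → P (C e) = B (e - 1) := by
    intro e he
    have h1 := htri (q_ e) (hq_lt e)
    -- `h1 : P ((P (q_ e) + 1) % Tn) = (P ((q_ e + Tn - 1) % Tn) + Tn - 1) % Tn`
    simp only [hC, hB, hSx, hSi]
    rw [h1]
    have h2 : (q_ e + Tn - 1) % Tn = q_ (e - 1) := hSi_q e he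
    rw [h2]
  -- lengths: `len (B (e-1)) = len (C e)`
  have hlenBC : ∀ e, 1 ≤ e → len (B (e - 1)) = len (C e) := by
    intro e he
    rw [← hPC e he, hlenP _ (hSx_lt _)]
  -- ### the data
  set s : ℕ := off + start p % n' with hs
  set lam : ℕ → ℕ := fun i => if i < d + 1 then len (q_ i) else 0 with hlam
  set t : ℕ → ℕ := fun i => off + (start (B i) % n' + len (B i)) with ht
  set kap : ℕ → ℕ := fun e => if 1 ≤ e ∧ e ≤ d then len (C e) else 0 with hkap
  set Ltot := ∑ i ∈ Finset.range (d + 1), len (q_ i) with hLtot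
  have hlam_eq : ∀ i, i < d + 1 → lam i = len (q_ i) := by
    intro i hi; simp only [hlam, if_pos hi]
  have hsum_lam : ∀ i, i ≤ d + 1 → ∑ i' ∈ Finset.range i, lam i' = ∑ i' ∈ Finset.range i, len (q_ i') := by
    intro i hi
    apply Finset.sum_congr rfl
    intro i' hi'
    rw [Finset.mem_range] at hi'
    exact hlam_eq i' (by omega)
  have hLtot_eq : ∑ i ∈ Finset.range (d + 1), lam i = Ltot := hsum_lam (d + 1) le_rfl
  -- ### modular facts (as congruences modulo `n'`)
  have hmodN : ∀ a, a % N % n' = a % n' := fun a => Nat.mod_mod_of_dvd a hNn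
  -- `start (D i) ≡ start (B i) + len (B i)`
  have hstartD : ∀ i, Nat.ModEq n' (start (P (q_ i))) (start (B i) + len (B i)) := by
    intro i
    have h1 := hcons (B i) (hSi_lt _)
    have h2 : (B i + 1) % Tn = P (q_ i) := succ_pred_mod _ (hP_lt _ (hq_lt i))
    rw [h2] at h1
    show start (P (q_ i)) % n' = (start (B i) + len (B i)) % n'
    rw [h1, hmodN]
  -- `start (C i) ≡ start (D i) + len (q_ i)`
  have hstartC : ∀ i, Nat.ModEq n' (start (C i)) (start (P (q_ i)) + len (q_ i)) := by
    intro i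
    have h1 := hcons (P (q_ i)) (hP_lt _ (hq_lt i))
    show start (C i) % n' = (start (P (q_ i)) + len (q_ i)) % n'
    simp only [hC, hSx]
    rw [h1, hmodN, hlenP _ (hq_lt i)]
  -- `start (q_ i) ≡ start p + Σ_{i'<i} len (q_ i')`
  have hstartq : ∀ i, Nat.ModEq n' (start (q_ i)) (start p + ∑ i' ∈ Finset.range i, len (q_ i')) := by
    intro i
    have h1 := start_add_mod start len hstart hcons p hp i
    show start (q_ i) % n' = (start p + ∑ i' ∈ Finset.range i, len (q_ i')) % n'
    simp only [hq_]
    rw [h1, hmodN]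
  have hpref : ∀ i, i < d + 1 → (∑ i' ∈ Finset.range i, len (q_ i')) + len (q_ i) ≤ Ltot :=
    fun i hi => prefixSum_add_le (fun i => len (q_ i)) hi
  -- the blocks, in the abbreviated form
  have hblk' : ∀ i, i < d + 1 → start (B i) % n' + (len (B i) + len (q_ i) + len (C i)) ≤ n' :=
    fun i hi => hblk i hi
  -- ### the witnesses
  refine ⟨s, t, lam, kap, ⟨?_, ?_, ?_, ?_, ?_, ?_, ?_⟩, ?_, ?_, ?_, ?_⟩
  · intro i hi; rw [hlam_eq i hi]; exact hlenA i hi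
  · intro e _
    simp only [hkap]
    split_ifs with h
    · exact hlenK e h.1 h.2
    · exact Nat.zero_le _
  · simp [hkap]
  · simp [hkap]
  · rw [hLtot_eq, hs]; have := harc; omega
  · intro i hi
    have hb := hblk' i hi
    constructor
    · -- `kap (i+1) ≤ t i`
      simp only [hkap, ht]
      split_ifs with h
      · have := hlenBC (i + 1) (by omega)
        rw [Nat.add_sub_cancel] at this
        rw [← this]
        omega
      · exact Nat.zero_le _
    · -- `t i + lam i + kap i ≤ n`
      rw [hlam_eq i hi]
      simp only [hkap, ht]
      have hk : (if 1 ≤ i ∧ i ≤ d then len (C i) else 0) ≤ len (C i) := by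
        split_ifs <;> omega
      omega
  · rw [hLtot_eq]
    exact hE
  · -- ### the `D`-constraints
    intro i hi j hj
    rw [hlam_eq i hi] at hj ⊢
    rw [hsum_lam i (by omega)]
    have hw := hword (q_ i) (hq_lt i) j hj
    have hb := hblk' i hi
    -- the left index
    have h1 : (start (P (q_ i)) + j) % n' = start (B i) % n' + (len (B i) + j) := by
      have hlt : start (B i) % n' + (len (B i) + j) < n' := by omega
      rw [(hstartD i).add_right j, add_assoc, add_mod_eq_of_lt hlt]
    -- the right index
    have h2 : (start (q_ i) + (len (q_ i) - 1 - j)) % n' =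
        start p % n' + ((∑ i' ∈ Finset.range i, len (q_ i')) + (len (q_ i) - 1 - j)) := by
      have hlt : start p % n' + ((∑ i' ∈ Finset.range i, len (q_ i')) + (len (q_ i) - 1 - j)) < n' := by
        have := hpref i hi; have := harc; omega
      rw [(hstartq i).add_right _, add_assoc, add_mod_eq_of_lt hlt]
    rw [h1, h2] at hw
    simp only [ht, hs]
    rw [show off + (start (B i) % n' + len (B i)) + j = off + (start (B i) % n' + (len (B i) + j)) by ring,
      hw]
    congr 2
    ring
  · -- ### the `F`-constraints
    intro e he1 hed j hj
    have hkap_e : kap e = len (C e) := by simp [hkap, he1, hed]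
    rw [hkap_e] at hj
    rw [hlam_eq e (by omega)]
    -- the third edge: `c = B (e-1) = P (C e)`
    have hc := hPC e he1
    have hlenc : len (B (e - 1)) = len (C e) := hlenBC e he1
    have hw := hword (B (e - 1)) (hSi_lt _) j (by rw [hlenc]; exact hj)
    have hPB : P (B (e - 1)) = C e := by rw [← hc, hPP _ (hSx_lt _)]
    rw [hPB] at hw
    have hbe := hblk' e (by omega)
    have hbe' := hblk' (e - 1) (by omega)
    -- left index
    have h1 : (start (C e) + j) % n' = start (B e) % n' + (len (B e) + len (q_ e) + j) := by
      have hlt : start (B e) % n' + (len (B e) + len (q_ e) + j) < n' := by omega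
      have hce : Nat.ModEq n' (start (C e) + j) (start (B e) + (len (B e) + len (q_ e) + j)) := by
        have := ((hstartC e).trans ((hstartD e).add_right _)).add_right j
        simpa only [add_assoc] using this
      rw [hce, add_mod_eq_of_lt hlt]
    -- right index
    have h2 : (start (B (e - 1)) + (len (B (e - 1)) - 1 - j)) % n' =
        start (B (e - 1)) % n' + (len (B (e - 1)) - 1 - j) :=
      add_mod_eq_of_lt (by omega)
    rw [h1, h2] at hw
    simp only [ht]
    rw [show off + (start (B e) % n' + len (B e)) + len (q_ e) + j =
      off + (start (B e) % n' + (len (B e) + len (q_ e) + j)) by ring, hw]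
    congr 2
    rw [hlenc]
    omega
  · rw [hLtot_eq]; simpa only [hs, add_assoc] using hreg1
  · rw [hLtot_eq]; simpa only [hs, add_assoc] using hreg2

end TokenCombs

end Literature.GroupTheory.CombinatorialGroupTheory

end
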